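import Mathlib
import Literature.Combinatorics.Enumerative.BregmanMinc

/-!
# Stub `stub_bregmanMinc` (crux stmt-MatrixMultiplication-8303, line bregman-entropy-window)

Crux `Summit.MatrixMultiplication.MatrixMultiplication.Theses.SnSubsetDichotomy.GlobalBranch`, line
`bregman-entropy-window` (lead's skeleton `Cruxes/GlobalBranch/Lines/bregman_entropy_window.lean`),
registered stub `stub_bregmanMinc`: the **Brégman–Minc inequality in set form** for subsets of the
symmetric group `S_n`.  For a nonempty `X ⊆ S_n` with row supports `r_i = #{σ i : σ ∈ X}`,

  `log #X ≤ ∑_{i : Fin n} log (r_i !) / r_i`,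

i.e. `#X ≤ ∏_i (r_i !)^(1/r_i)` — Brégman's theorem [Bregman1973, Thm 1] (Minc's conjecture) applied
to the `0/1` support pattern of `X`.  In the line it feeds `log #X + suppDefect X ≤ log n!` and, with
`stub_quotientCard`, `log #S + log #T + suppDefect (S⁻¹T) ≤ log n!`.

The proof is the `α := Fin n` instance of the general theorem
`Literature.Combinatorics.Enumerative.log_card_le_sum_log_factorial_div` (Schrijver's 1978 proof,
run directly on finite sets of permutations of a finite type).
-/

set_option linter.dupNamespace false

namespace Summit.MatrixMultiplication.MatrixMultiplication.Theorems.GlobalBranch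

open scoped BigOperators Classical

/-- **Stub `stub_bregmanMinc` — Brégman–Minc in set form.**  For every `n` and every nonempty finite
set `X` of permutations of `Fin n` with row supports `r_i = #{σ i : σ ∈ X}`:
`log #X ≤ ∑_i log (r_i !) / r_i` (equivalently `#X ≤ ∏_i (r_i !)^(1/r_i)`; Minc's conjecture 1963,
Brégman's theorem 1973, here via Schrijver's 1978 proof for sets of permutations,
`Literature.Combinatorics.Enumerative.log_card_le_sum_log_factorial_div`). [cite: Bregman1973, Thm 1] -/
theorem stub_bregmanMinc : ∀ (n : ℕ) (X : Finset (Equiv.Perm (Fin n))), X.Nonempty →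
    Real.log (X.card : ℝ) ≤
      ∑ i : Fin n, Real.log (((X.image (fun σ => σ i)).card).factorial : ℝ) /
        ((X.image (fun σ => σ i)).card : ℝ) :=
  fun _ X hX => Literature.Combinatorics.Enumerative.log_card_le_sum_log_factorial_div X hX

end Summit.MatrixMultiplication.MatrixMultiplication.Theorems.GlobalBranch
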